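import Literature.AnabelianGeometry.EtaleTheta.SettingModelTateZClass
import Literature.AnabelianGeometry.EtaleTheta.SettingModelTateInversionXuu
import Literature.AnabelianGeometry.EtaleTheta.EtaleThetaDataOfClass
import HarnessLib

/-!
# The STAGE-2 model: the `eta_res` clause of [EtTh] Def. 2.7 for the class of record `etaDdχq` at `X̲̲ := Huuχq`
# — `DoubleUnderline` for EVERY étale-theta datum over `modelχq` carrying `etaDdχq` (proof-only)

Mochizuki, *The étale theta function …*, Publ. RIMS **45** (2009) [EtTh], Def. 2.5 (i) p. 39 (`X̲̲ → X`), Def. 2.7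
p. 41 ("`η̈^Θ` restricted to `Π^tp_Ÿ̲̲` has coefficients in `l·Δ_Θ`") [cite: MochizukiEtTh2009, Def 2.7 p.41].  abc-iut
cell, layer L2, prover abc-iut-L2-d1 (gen 5); PROOF-ONLY junction (R78 cluster, hand #2′q; answer to abc-iut-L2-t8's
12:03Z request) of
* abc-iut-L2-t6's stage-2 class of record `etaDdχq p i j hj := infl (zClassYddχq)` (`SettingModelTateZClass`, F7q
  part 1: the `z`-part cocycle `zPartχq h = h · (refLiftχq h)⁻¹`, `refReprχq h = ⟨b^{ŷ(h)}, aug^Θ h⟩`);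
* this seat's `Huuχq p i j l hl = dUU l ⋊ G_{ℚ_p}`, `map_toTheta_Huuχq_modelχq` (`θ(Π^tp_X̲̲) ∩ Δ_Θ = l·Δ_Θ`) and
  `EtaleThetaData.doubleUnderlineχqOfEtaRes` (`SettingModelTateDoubleUnderline`), `bPowGfp_mem_dUU`
  (`SettingModelTateInversionXuu`).

The point (`zPartχq_toTheta_mem_lDeltaTheta_of_mem_Huuχq`): for `g ∈ Π^tp_Y ∩ Π^tp_X̲̲` the value of the `z`-cocycle
at `θ(g)` is `θ(g · refReprχq(θ g)⁻¹)`, and `refReprχq(θ g) = ⟨b^{ŷ(g)}, g.right⟩ ∈ Π^tp_X̲̲` (the `b`-axis lies in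
`dUU l`); so the value lies in `θ(Π^tp_X̲̲) ∩ Δ_Θ = l·Δ_Θ` — NO level computation.  Hence
**`eta_res_etaDdχq`** (the `eta_res` clause for `etaDdχq`, any `E`-independent) and **`exists_doubleUnderline_etaDdχq`**:
every `E` over `modelχq p i j hj` with `E.etaDd = etaDdχq p i j hj` admits the `DoubleUnderline l` structure
`X̲̲ := Huuχq p i j l hl`, namely `E.doubleUnderlineχqOfEtaRes p i j l hl (hE ▸ eta_res_etaDdχq p i j hj l hl)` (E-generic,
so abc-iut-L2-t8's stage-2 capstone may key on any section datum and NAME this term there; this file stays proof-only).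
SEMI-SYNTHETIC MODEL, consistency evidence only; nothing of [EtTh] asserted; no side taken on [IUTchIII] Cor. 3.12.
-/

noncomputable section

namespace Literature.AnabelianGeometry.EtaleTheta.SettingModel

open Literature.AnabelianGeometry.SemiGraphs _root_.Function

variable (p : ℕ) [Fact p.Prime] (i j : ℤ) (hj : Even j) (l : ℕ+) (hl : Odd (l : ℕ))

/-- `refReprχq h = ⟨b^{ŷ(h)}, aug^Θ h⟩ ∈ Π^tp_X̲̲`: the `b`-axis lies in `dUU l` and the Galois factor is unrestricted.
[cite: MochizukiEtTh2009, Def 2.5 (i) p.39] -/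
theorem refReprχq_mem_Huuχq (h : CurveTheta.GTheta (curveχq p i j)) : refReprχq p i j h ∈ Huuχq p i j l hl := by
  change (refReprχq p i j h).left ∈ dUU l ∧ (refReprχq p i j h).right ∈ (⊤ : Subgroup (GQp p))
  rw [refReprχq_left]
  exact ⟨bPowGfp_mem_dUU l _, Subgroup.mem_top _⟩

/-- For `g ∈ Π^tp_X̲̲`, the `z`-part of `θ(g)` lies in `θ(Π^tp_X̲̲)`: it is `θ(g · refReprχq(θ g)⁻¹)` with both factors
in `Π^tp_X̲̲`. [cite: MochizukiEtTh2009, Def 2.7 p.41] -/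
theorem zPartχq_toTheta_mem_map_Huuχq {g : PiTpχq p i j} (hg : g ∈ Huuχq p i j l hl) :
    zPartχq p i j ((ThetaSetting.modelχq p i j hj).toTheta g) ∈
      (Huuχq p i j l hl).map (ThetaSetting.modelχq p i j hj).toTheta := by
  rw [zPartχq_def, refLiftχq_def]
  change CurveTheta.toTheta (curveχq p i j) g * (CurveTheta.toTheta (curveχq p i j) (refReprχq p i j _))⁻¹ ∈
    (Huuχq p i j l hl).map (CurveTheta.toTheta (curveχq p i j))
  rw [← map_inv, ← map_mul]
  exact Subgroup.mem_map_of_mem _ (mul_mem hg (inv_mem (refReprχq_mem_Huuχq p i j l hl _)))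

/-- **The `eta_res` clause at the cocycle level** (stage 2): for `g ∈ Π^tp_Y ∩ Π^tp_X̲̲` the `z`-cocycle value at
`θ(g)` lies in `l·Δ_Θ = θ(Π^tp_X̲̲) ∩ Δ_Θ` (this seat's `map_toTheta_Huuχq_modelχq`; abc-iut-L2-t6's
`zPartχq_mem_deltaTheta`). [cite: MochizukiEtTh2009, Def 2.7 p.41] -/
theorem zPartχq_toTheta_mem_lDeltaTheta_of_mem_Huuχq {g : PiTpχq p i j}
    (hgY : g ∈ (ThetaSetting.modelχq p i j hj).GtpY) (hg : g ∈ Huuχq p i j l hl) :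
    zPartχq p i j ((ThetaSetting.modelχq p i j hj).toTheta g) ∈ (ThetaSetting.modelχq p i j hj).lDeltaTheta l := by
  rw [← map_toTheta_Huuχq_modelχq p i j l hl]
  exact Subgroup.mem_inf.mpr
    ⟨zPartχq_toTheta_mem_map_Huuχq p i j hj l hl hg, zPartχq_mem_deltaTheta p i j hj ⟨g, hgY, rfl⟩⟩

/-- **`η̈♯|_{Π^tp_Ÿ ∩ Π^tp_X̲̲}` has coefficients in `l·Δ_Θ`** (Def. 2.7, stage 2): the `eta_res` clause of
`DoubleUnderline` for the class of record `etaDdχq` at `X̲̲ := Huuχq` — witnessed by the restriction to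
`Π^tp_Ÿ ∩ Π^tp_X̲̲` of the inflation of abc-iut-L2-t6's `z`-cocycle (whose class IS `res (etaDdχq)`, by `rfl`), whose
value at `g` is `zPartχq (θ g)`. [cite: MochizukiEtTh2009, Def 2.7 p.41] -/
theorem eta_res_etaDdχq :
    ∃ (f : ↥((ThetaSetting.modelχq p i j hj).GtpYdd ⊓ Huuχq p i j l hl) → (ThetaSetting.modelχq p i j hj).DeltaTheta)
      (hf : f ∈ contCocycles (ThetaSetting.modelχq p i j hj).toTheta (ThetaSetting.modelχq p i j hj).DeltaTheta
        ((ThetaSetting.modelχq p i j hj).GtpYdd ⊓ Huuχq p i j l hl)),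
      (∀ g, (f g : (ThetaSetting.modelχq p i j hj).GtpTheta) ∈ (ThetaSetting.modelχq p i j hj).lDeltaTheta l) ∧
        ContH1.mk f hf = ContH1.res (ThetaSetting.modelχq p i j hj).toTheta (ThetaSetting.modelχq p i j hj).DeltaTheta
          inf_le_left (etaDdχq p i j hj) :=
  let c := ContH1.resCocycle (ThetaSetting.modelχq p i j hj).toTheta (ThetaSetting.modelχq p i j hj).DeltaTheta
    (inf_le_left : (ThetaSetting.modelχq p i j hj).GtpYdd ⊓ Huuχq p i j l hl ≤ (ThetaSetting.modelχq p i j hj).GtpYdd)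
    (ContH1.inflCocycle (ThetaSetting.modelχq p i j hj).DeltaTheta (ThetaSetting.modelχq p i j hj).toTheta
      (ThetaSetting.modelχq p i j hj).continuous_toTheta le_rfl
      ⟨zFunχq p i j hj _ (Subgroup.map_mono (ThetaSetting.modelχq p i j hj).GtpYdd_le_GtpY),
        zFunχq_mem p i j hj _ (Subgroup.map_mono (ThetaSetting.modelχq p i j hj).GtpYdd_le_GtpY)⟩)
  ⟨c.1, c.2, fun g =>
    show zPartχq p i j ((ThetaSetting.modelχq p i j hj).toTheta (g : PiTpχq p i j)) ∈ _ from
      zPartχq_toTheta_mem_lDeltaTheta_of_mem_Huuχq p i j hj l hl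
        ((ThetaSetting.modelχq p i j hj).GtpYdd_le_GtpY (Subgroup.mem_inf.mp g.2).1) (Subgroup.mem_inf.mp g.2).2,
    rfl⟩

/-- **Census form (stage 2)**: every étale-theta datum over `modelχq p i j hj` carrying the class of record `etaDdχq`
admits, for every odd `l`, a `DoubleUnderline l` whose `Π^tp_X̲̲` is the explicit `Huuχq p i j l hl` — namely
`E.doubleUnderlineχqOfEtaRes p i j l hl (hE ▸ eta_res_etaDdχq p i j hj l hl)` (all clauses of Def. 2.5 (i) / 2.7
discharged; E-generic in the Kummer part, so a capstone may key on any section datum). [cite: MochizukiEtTh2009, Def 2.7 p.41] -/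
theorem exists_doubleUnderline_etaDdχq (E : (ThetaSetting.modelχq p i j hj).EtaleThetaData)
    (hE : E.etaDd = etaDdχq p i j hj) : ∃ X : E.DoubleUnderline l, X.Huu = Huuχq p i j l hl :=
  ⟨E.doubleUnderlineχqOfEtaRes p i j l hl (hE ▸ eta_res_etaDdχq p i j hj l hl), rfl⟩

/-- **NV**: for every prime `p`, all `i`, even `j` and odd `l`, some étale-theta datum over the stage-2 model carries the
class of record `etaDdχq` AND a `DoubleUnderline l` with `Π^tp_X̲̲ = Huuχq` (the honest-degenerate datum
`etaleThetaDataOfClass` of any Kummer datum; Kummer data over `modelχq` exist by abc-iut-L2-t5/L6-d5's cores — here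
we only quantify over them). [cite: MochizukiEtTh2009, Def 2.7 p.41] -/
theorem exists_doubleUnderline_etaleThetaDataOfClass_etaDdχq (E₀ : (ThetaSetting.modelχq p i j hj).KummerData) :
    ∃ X : (E₀.etaleThetaDataOfClass (etaDdχq p i j hj)).DoubleUnderline l, X.Huu = Huuχq p i j l hl :=
  exists_doubleUnderline_etaDdχq p i j hj l hl _ rfl

end Literature.AnabelianGeometry.EtaleTheta.SettingModel

end
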